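import Literature.AlgebraicGeometry.HodgeTheory.FermatDiagonalAction
import Literature.AlgebraicGeometry.Motives.ProjectiveSpaceCoordinateEmbedding
import HarnessLib

/-!
# The coordinate hyperplane sections `Xⁿₘ ≅ Xⁿ⁺¹ₘ ∩ {x_{k₀} = 0} ↪ Xⁿ⁺¹ₘ` of the Fermat hypersurfaces

Family `hodge`, layer `Literature/AlgebraicGeometry/HodgeTheory`. Geometric input of the inductive
structure of the Fermat varieties used for the middle degree of the named fact
`hodgeClasses_algebraic_fermat` (file `FermatHodgeConjecture`; Shioda, Math. Ann. 245 (1979) §1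
and Shioda–Katsura, Tôhoku Math. J. 31 (1979) §1: `Xⁿ⁻¹ₘ` is the hyperplane section
`Xⁿₘ ∩ {x_{n+1} = 0}`; Ran, Compositio Math. 42 (1980) §1: `X ∩ {X_{n+1} = 0}`). For the standard
models `Xⁿₘ = SmoothHypersurface.hypersurface (fermatPolynomial ℂ n m) ⊂ ℙⁿ⁺¹_ℂ` and a coordinate
`k₀ : Fin (n + 3)`, everything PROVED (no named facts):

* `skipGraded_fermatPolynomial` — the coordinate substitution `x_{k₀} ↦ 0` sends the Fermat form
  in `n + 3` variables to the Fermat form in `n + 2` variables (`m ≠ 0`);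
* `fermatSection k₀ : Xⁿₘ ⟶ Xⁿ⁺¹ₘ` over `ℂ` — the restriction of the coordinate embedding
  `ProjectiveSpace.skipMap k₀ : ℙⁿ⁺¹ ↪ ℙⁿ⁺²` (`Motives/ProjectiveSpaceCoordinateEmbedding`) to the
  Fermat hypersurfaces, through the universal property of the reduced induced structure
  (`Motives.liftOfRangeSubset`); `fermatSection_comp_ι`; a CLOSED IMMERSION
  (`isClosedImmersion_fermatSection_left`);
* `fermatCoordHyperplane N m k` — the Zariski-closed subset `Xᴺₘ ∩ {x_k = 0}` (preimage of
  `ℙ ∖ D₊(x_k)`; `notMem_fermatCoordHyperplane_iff`: a complex point lies off it iff its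
  homogeneous coordinate `z_k ≠ 0`), and
  **`range_fermatSection : range (fermatSection k₀) = fermatCoordHyperplane (n+1) m k₀`**;
* equivariance under the diagonal symmetries `μₘ`: `fermatSection_comp_diagonalAut` —
  `fermatSection k₀ ≫ g_a = g_{a ∘ k₀.succAbove} ≫ fermatSection k₀` for `a ∈ μₘⁿ⁺³`; in particular
  the rotation of the coordinate `x_{k₀}` FIXES the section pointwise
  (`diagonalAut_single_comp_fermatSection`: `g_{(1,…,ζ,…,1)} ∘ fermatSection = fermatSection`).

## References

* [Shioda1979HodgeFermat] T. Shioda, The Hodge conjecture for Fermat varieties, Math. Ann. 245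
  (1979) 175–184, §1.
* [Ran1980] Z. Ran, Cycles on Fermat hypersurfaces, Compositio Math. 42 (1980), §1.
* [Hartshorne1977] R. Hartshorne, Algebraic Geometry (1977), II Ex. 3.11 (d), II Ex. 3.12.
* [SerreGAGA1956] J.-P. Serre, GAGA, Ann. Inst. Fourier 6 (1956), §2 n°5.
-/

noncomputable section

open CategoryTheory AlgebraicGeometry MvPolynomial

namespace Literature.AlgebraicGeometry.HodgeTheory

open Literature.AlgebraicGeometry.Motives Literature.NumberTheory.Transcendental

attribute [local instance] MvPolynomial.gradedAlgebra Motives.ProjBaseChange.algebraBase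

variable {n : ℕ} {m : ℕ}

/-- The grading of `ℂ[x₀, …, x_{n+2}]` (`ℙⁿ⁺² = Proj 𝓐`, ambient space of `Xⁿ⁺¹ₘ`). [folklore] -/
local notation "𝓐" => MvPolynomial.homogeneousSubmodule (Fin (n + 3)) ℂ

/-- The grading of `ℂ[y₀, …, y_{n+1}]` (`ℙⁿ⁺¹ = Proj 𝓑`, ambient space of `Xⁿₘ`). [folklore] -/
local notation "𝓑" => MvPolynomial.homogeneousSubmodule (Fin (n + 2)) ℂ

/-- Local notation: the standard Fermat hypersurface `Xⁿₘ`. -/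
local notation "𝕏" n' ", " m' => SmoothHypersurface.hypersurface (fermatPolynomial ℂ n' m')

/-- Local notation: its closed immersion into projective space. -/
local notation "ι" n' ", " m' => SmoothHypersurface.hypersurfaceι (fermatPolynomial ℂ n' m')

/-! ### The substitution `x_{k₀} ↦ 0` on the Fermat form -/

/-- **`s(x₀ᵐ + ⋯ + x_{n+2}ᵐ) = y₀ᵐ + ⋯ + y_{n+1}ᵐ`** for the coordinate substitution
`s : x_{k₀} ↦ 0, x_{k₀.succAbove j} ↦ yⱼ` (`m ≠ 0`). [cite: Shioda1979HodgeFermat, §1] -/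
theorem skipGraded_fermatPolynomial (hm : m ≠ 0) (k₀ : Fin (n + 3)) :
    ProjectiveSpace.skipGraded k₀ (fermatPolynomial ℂ (n + 1) m) = fermatPolynomial ℂ n m := by
  rw [ProjectiveSpace.skipGraded_apply, fermatPolynomial, fermatPolynomial, map_sum,
    Fin.sum_univ_succAbove _ k₀]
  simp only [map_pow, aeval_X, ProjectiveSpace.skipSubst_self, ProjectiveSpace.skipSubst_succAbove,
    zero_pow hm, zero_add]

/-! ### The coordinate hyperplane section `Z_k = Xⁿₘ ∩ {x_k = 0}` -/

section Hyperplane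

variable {N : ℕ}

/-- The grading of `ℂ[x₀, …, x_{N+1}]` (local notation for this section). [folklore] -/
local notation "𝓒" => MvPolynomial.homogeneousSubmodule (Fin (N + 2)) ℂ

/-- **The coordinate hyperplane section `Z_k = Xᴺₘ ∩ {x_k = 0}`** as a Zariski-closed subset of the
standard Fermat hypersurface of dimension `N`: the preimage of the closed set `ℙᴺ⁺¹ ∖ D₊(x_k)`
under the closed immersion `Xᴺₘ ↪ ℙᴺ⁺¹` (for `N ≥ 1` it is the image of the Fermat hypersurface of
one dimension less, `range_fermatSection`). [cite: Shioda1979HodgeFermat, §1] [cite: Ran1980, §1 Lemma 1.4] -/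
def fermatCoordHyperplane (N m : ℕ) (k : Fin (N + 2)) : Set (𝕏 N, m).left :=
  {x | (ι N, m).left.base x ∉
    Proj.basicOpen (MvPolynomial.homogeneousSubmodule (Fin (N + 2)) ℂ) (MvPolynomial.X k)}

/-- `Z_k` is Zariski closed. [folklore] -/
theorem isClosed_fermatCoordHyperplane (k : Fin (N + 2)) : IsClosed (fermatCoordHyperplane N m k) := by
  have hopen : IsOpen {x : (𝕏 N, m).left | (ι N, m).left.base x ∈ Proj.basicOpen 𝓒 (MvPolynomial.X k)} :=
    (Proj.basicOpen 𝓒 (MvPolynomial.X k)).isOpen.preimage (ι N, m).left.continuous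
  rw [← isOpen_compl_iff]
  convert hopen using 1
  ext x
  simp [fermatCoordHyperplane]

/-- `x ∈ Z_k` iff its image in `ℙᴺ⁺¹` lies on the hyperplane `V₊(x_k)`. [folklore] -/
theorem mem_fermatCoordHyperplane_iff (k : Fin (N + 2)) (x : (𝕏 N, m).left) :
    x ∈ fermatCoordHyperplane N m k ↔
      (ι N, m).left.base x ∈ ProjectiveSpectrum.zeroLocus 𝓒 {MvPolynomial.X k} := by
  rw [mem_zeroLocus_iff_notMem_basicOpen]; rfl

/-- **A complex point lies off `Z_k` iff its homogeneous coordinate `z_k` is nonzero**, i.e. iff it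
lies in the domain of the `k`-th standard chart of `ℙ(ℂᴺ⁺²)`. [cite: SerreGAGA1956, §2 n°5] -/
theorem notMem_fermatCoordHyperplane_iff (k : Fin (N + 2)) (P : ComplexPoints (𝕏 N, m)) :
    P.pt ∉ fermatCoordHyperplane N m k ↔
      hypersurfacePoint (ι N, m) P ∈ Projectivization.stdChartSource k := by
  rw [fermatCoordHyperplane, Set.mem_setOf_eq, not_not, ← Projectivization.stdChart_source,
    ← pt_map_mem_projChartOpen_iff, mem_projChartOpen_iff, AlgPoints.pt_map]

end Hyperplane

/-! ### The section `Xⁿₘ ⟶ Xⁿ⁺¹ₘ` -/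

section Section

variable (hm : m ≠ 0) (k₀ : Fin (n + 3))
include hm

/-- The composite `Xⁿₘ ↪ ℙⁿ⁺¹ ↪ ℙⁿ⁺²` lands in `V₊(F) = Xⁿ⁺¹ₘ` (`s F = F'`, so the preimage of
`D₊(F)` is `D₊(F')`, which misses `Xⁿₘ`). [cite: Shioda1979HodgeFermat, §1] -/
theorem range_ι_comp_skipMap_subset :
    Set.range ((ι n, m).left ≫ (ProjectiveSpace.skipMap k₀).left) ⊆ Set.range (ι (n + 1), m).left := by
  rintro _ ⟨x, rfl⟩
  have hx : (ι n, m).left x ∈ ProjectiveSpectrum.zeroLocus 𝓑 {fermatPolynomial ℂ n m} :=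
    (Set.ext_iff.mp (SmoothHypersurface.range_hypersurfaceι _) _).mp ⟨x, rfl⟩
  rw [mem_zeroLocus_iff_notMem_basicOpen] at hx
  refine (Set.ext_iff.mp (SmoothHypersurface.range_hypersurfaceι _) _).mpr
    ((mem_zeroLocus_iff_notMem_basicOpen _ _).mpr fun h ↦ hx ?_)
  have h' : (ι n, m).left x ∈ (ProjectiveSpace.skipMap k₀).left ⁻¹ᵁ
      Proj.basicOpen 𝓐 (fermatPolynomial ℂ (n + 1) m) := h
  rwa [ProjectiveSpace.skipMap_preimage_basicOpen, skipGraded_fermatPolynomial hm] at h'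

/-- **The coordinate hyperplane section `Xⁿₘ ⟶ Xⁿ⁺¹ₘ`** (over `ℂ`): the coordinate embedding
`[y] ↦ [y with 0 in slot k₀]` restricted to the Fermat hypersurfaces, through the universal property
of the reduced induced structure (`Motives.liftOfRangeSubset`, Hartshorne II Ex. 3.11 (d)).
[cite: Shioda1979HodgeFermat, §1] [cite: Ran1980, §1] -/
def fermatSection : (𝕏 n, m) ⟶ (𝕏 (n + 1), m) :=
  Over.homMk (liftOfRangeSubset (ι (n + 1), m).left ((ι n, m).left ≫ (ProjectiveSpace.skipMap k₀).left)
    (range_ι_comp_skipMap_subset hm k₀)) (by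
      rw [← Over.w (ι (n + 1), m), liftOfRangeSubset_comp_assoc, Category.assoc,
        Over.w (ProjectiveSpace.skipMap k₀), Over.w (ι n, m)])

/-- `fermatSection ≫ ι = ι' ≫ skipMap` on underlying schemes. [folklore] -/
@[reassoc]
theorem fermatSection_left_comp_ι :
    (fermatSection hm k₀).left ≫ (ι (n + 1), m).left = (ι n, m).left ≫ (ProjectiveSpace.skipMap k₀).left :=
  liftOfRangeSubset_comp _ _ (range_ι_comp_skipMap_subset hm k₀)

/-- `fermatSection ≫ ι = ι' ≫ skipMap` over `ℂ`. [folklore] -/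
@[reassoc]
theorem fermatSection_comp_ι :
    fermatSection hm k₀ ≫ (ι (n + 1), m) = (ι n, m) ≫ ProjectiveSpace.skipMap k₀ := by
  ext : 1
  rw [Over.comp_left, Over.comp_left]
  exact fermatSection_left_comp_ι hm k₀

/-- `ι (fermatSection x) = skipMap (ι' x)` on points. [folklore] -/
theorem ι_fermatSection_apply (x : (𝕏 n, m).left) :
    (ι (n + 1), m).left ((fermatSection hm k₀).left x) = (ProjectiveSpace.skipMap k₀).left ((ι n, m).left x) := by
  rw [← Scheme.Hom.comp_apply, fermatSection_left_comp_ι, Scheme.Hom.comp_apply]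

/-- **`fermatSection` is a closed immersion** (its composite with the closed immersion `ι` is the
closed immersion `ι' ≫ skipMap`). [cite: Hartshorne1977, II Ex. 3.12] -/
instance isClosedImmersion_fermatSection_left : IsClosedImmersion (fermatSection hm k₀).left := by
  have h : IsClosedImmersion ((fermatSection hm k₀).left ≫ (ι (n + 1), m).left) := by
    rw [fermatSection_left_comp_ι]
    infer_instance
  exact IsClosedImmersion.of_comp_isClosedImmersion _ (ι (n + 1), m).left

/-- A point of `ℙⁿ⁺¹` lying on `V₊(F')` is in the image of `ι' : Xⁿₘ ↪ ℙⁿ⁺¹` iff it is not in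
`D₊(F')`; here: the point `q` with `skipMap q = ι x'` for `x' ∈ Xⁿ⁺¹ₘ` lies in the image of `ι'`.
[folklore] -/
theorem exists_eq_of_skipMap_eq {q : (projectiveSpace (n + 1) ℂ).left} {x' : (𝕏 (n + 1), m).left}
    (hq : (ProjectiveSpace.skipMap k₀).left q = (ι (n + 1), m).left x') :
    ∃ x : (𝕏 n, m).left, (ι n, m).left x = q := by
  have hx' : (ι (n + 1), m).left x' ∈ ProjectiveSpectrum.zeroLocus 𝓐 {fermatPolynomial ℂ (n + 1) m} :=
    (Set.ext_iff.mp (SmoothHypersurface.range_hypersurfaceι _) _).mp ⟨x', rfl⟩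
  rw [mem_zeroLocus_iff_notMem_basicOpen] at hx'
  refine (Set.ext_iff.mp (SmoothHypersurface.range_hypersurfaceι _) q).mpr
    ((mem_zeroLocus_iff_notMem_basicOpen _ q).mpr fun h ↦ hx' ?_)
  rw [← skipGraded_fermatPolynomial hm k₀] at h
  have h2 : q ∈ (ProjectiveSpace.skipMap k₀).left ⁻¹ᵁ Proj.basicOpen 𝓐 (fermatPolynomial ℂ (n + 1) m) := h
  have h3 : (ProjectiveSpace.skipMap k₀).left q ∈ Proj.basicOpen 𝓐 (fermatPolynomial ℂ (n + 1) m) := h2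
  rwa [hq] at h3

/-- **The image of the section is the coordinate hyperplane section `Z_{k₀}`.**
[cite: Shioda1979HodgeFermat, §1] [cite: Ran1980, §1 Lemma 1.4] -/
theorem range_fermatSection :
    Set.range (fermatSection hm k₀).left = fermatCoordHyperplane (n + 1) m k₀ := by
  ext x'
  rw [mem_fermatCoordHyperplane_iff, ← ProjectiveSpace.range_skipMap k₀]
  constructor
  · rintro ⟨x, rfl⟩
    exact ⟨(ι n, m).left x, (ι_fermatSection_apply hm k₀ x).symm⟩
  · rintro ⟨q, hq⟩
    obtain ⟨x, rfl⟩ := exists_eq_of_skipMap_eq hm k₀ hq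
    refine ⟨x, (ι (n + 1), m).left.isClosedEmbedding.injective ?_⟩
    rw [ι_fermatSection_apply]
    exact hq

end Section

/-! ### Equivariance under the diagonal symmetries `μₘ` -/

section Equivariance

variable (hm : m ≠ 0) (k₀ : Fin (n + 3))

/-- Restricting a diagonal symmetry of `ℂ[x₀, …, x_{n+2}]` along `k₀.succAbove`: `a' = a ∘ k₀.succAbove`
is in `μₘⁿ⁺²` when `a ∈ μₘⁿ⁺³`. [cite: Shioda1979HodgeFermat, §1] -/
theorem comp_succAbove_mem_fermatGroup {a : Fin (n + 3) → ℂˣ} (ha : a ∈ fermatGroup (n + 1) m) :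
    (a ∘ k₀.succAbove) ∈ fermatGroup n m := by
  rw [mem_fermatGroup_iff] at ha ⊢
  exact fun j ↦ ha (k₀.succAbove j)

/-- The substitutions commute: `s ∘ σ_a = σ_{a ∘ k₀.succAbove} ∘ s` on `ℂ[x₀, …, x_{n+2}]`.
[folklore] -/
theorem skipGraded_aeval_diagonalSubst (a : Fin (n + 3) → ℂˣ) (p : MvPolynomial (Fin (n + 3)) ℂ) :
    ProjectiveSpace.skipGraded k₀ (aeval (diagonalSubst a) p) =
      aeval (diagonalSubst (a ∘ k₀.succAbove)) (ProjectiveSpace.skipGraded k₀ p) := by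
  rw [ProjectiveSpace.skipGraded_apply, ProjectiveSpace.skipGraded_apply, ← AlgHom.comp_apply,
    ← AlgHom.comp_apply, MvPolynomial.comp_aeval, MvPolynomial.comp_aeval]
  have h : (fun i ↦ aeval (ProjectiveSpace.skipSubst (k := ℂ) k₀) (diagonalSubst a i)) =
      fun i ↦ aeval (diagonalSubst (a ∘ k₀.succAbove)) (ProjectiveSpace.skipSubst (k := ℂ) k₀ i) := by
    funext i
    refine Fin.succAboveCases k₀ ?_ (fun j ↦ ?_) i
    · rw [diagonalSubst_apply, map_mul, aeval_X, ProjectiveSpace.skipSubst_self, mul_zero, map_zero]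
    · rw [diagonalSubst_apply, map_mul, aeval_C, aeval_X, ProjectiveSpace.skipSubst_succAbove, aeval_X,
        diagonalSubst_apply, MvPolynomial.algebraMap_eq]
      rfl
  rw [h]

/-- `Proj.map` does not depend on the proof of the irrelevance hypothesis, nor on the presentation
of the graded homomorphism (`ℂ[x₀, …, x_{n+2}] → ℂ[y₀, …, y_{n+1}]`). [folklore] -/
theorem projMap_congr {f f' : 𝓐 →+*ᵍ 𝓑} (h : f = f')
    (hf : HomogeneousIdeal.irrelevant 𝓑 ≤ (HomogeneousIdeal.irrelevant 𝓐).map f)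
    (hf' : HomogeneousIdeal.irrelevant 𝓑 ≤ (HomogeneousIdeal.irrelevant 𝓐).map f') :
    Proj.map f hf = Proj.map f' hf' := by
  subst h; rfl

/-- The same for graded endomorphisms of `ℂ[y₀, …, y_{n+1}]`. [folklore] -/
theorem projMap_congr' {f f' : 𝓑 →+*ᵍ 𝓑} (h : f = f')
    (hf : HomogeneousIdeal.irrelevant 𝓑 ≤ (HomogeneousIdeal.irrelevant 𝓑).map f)
    (hf' : HomogeneousIdeal.irrelevant 𝓑 ≤ (HomogeneousIdeal.irrelevant 𝓑).map f') :
    Proj.map f hf = Proj.map f' hf' := by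
  subst h; rfl

/-- **The coordinate embedding commutes with the diagonal symmetries**:
`skipMap ≫ ([z] ↦ [a • z]) = ([y] ↦ [a' • y]) ≫ skipMap`, `a' = a ∘ k₀.succAbove` (both sides are
`Proj.map` of the same graded homomorphism, Mathlib `Proj.map_comp`). [cite: Hartshorne1977, II Ex. 2.14] -/
theorem skipMap_comp_diagonalProjMap (a : Fin (n + 3) → ℂˣ) :
    ProjectiveSpace.skipMap k₀ ≫ diagonalProjMap a =
      diagonalProjMap (a ∘ k₀.succAbove) ≫ ProjectiveSpace.skipMap k₀ := by
  ext : 1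
  rw [Over.comp_left, Over.comp_left, ProjectiveSpace.skipMap_left, ProjectiveSpace.skipMapHom_eq,
    diagonalProjMap, diagonalProjMap, ProjectiveSpace.substMap_left, ProjectiveSpace.substMap_left,
    ProjectiveSpace.substMapHom_eq, ProjectiveSpace.substMapHom_eq]
  have key : (ProjectiveSpace.skipGraded k₀).comp
      (ProjectiveSpace.substGraded (diagonalSubst a) (isHomogeneous_diagonalSubst a)) =
      (ProjectiveSpace.substGraded (diagonalSubst (a ∘ k₀.succAbove))
        (isHomogeneous_diagonalSubst (a ∘ k₀.succAbove))).comp (ProjectiveSpace.skipGraded k₀) := by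
    refine GradedRingHom.ext fun p ↦ ?_
    change ProjectiveSpace.skipGraded k₀ (aeval (diagonalSubst a) p) =
      aeval (diagonalSubst (a ∘ k₀.succAbove)) (ProjectiveSpace.skipGraded k₀ p)
    exact skipGraded_aeval_diagonalSubst k₀ a p
  exact (Proj.map_comp _ _ _ _).symm.trans ((projMap_congr key _ _).trans (Proj.map_comp _ _ _ _))

/-- The symmetry `(1, …, ζ, …, 1)` (`ζ` in slot `k₀`) restricts along `k₀.succAbove` to `1`. [folklore] -/
theorem fermatGroupSingle_comp_succAbove (ζ : rootsOfUnity m ℂ) :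
    ((fermatGroupSingle k₀ ζ : fermatGroup (n + 1) m) : Fin (n + 3) → ℂˣ) ∘ k₀.succAbove = 1 := by
  funext j
  simp [fermatGroupSingle, fermatGroupEquiv_apply_coe]

omit k₀ in
/-- The automorphism of the trivial symmetry is the identity. [folklore] -/
theorem diagonalAut_eq_id_of_eq_one {F : MvPolynomial (Fin (n + 2)) ℂ} {a : Fin (n + 2) → ℂˣ}
    (ha : a ∈ diagonalStabilizer F) (h1 : a = 1) : diagonalAut F ha = 𝟙 _ := by
  subst h1
  -- `diagonalProjMap 1 = 𝟙`
  have hP : diagonalProjMap (1 : Fin (n + 2) → ℂˣ) = 𝟙 _ := by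
    ext : 1
    rw [diagonalProjMap, ProjectiveSpace.substMap_left, ProjectiveSpace.substMapHom_eq, Over.id_left]
    have key : ProjectiveSpace.substGraded (diagonalSubst (1 : Fin (n + 2) → ℂˣ))
        (isHomogeneous_diagonalSubst 1) = GradedRingHom.id _ := by
      refine GradedRingHom.ext fun p ↦ ?_
      change aeval (diagonalSubst (1 : Fin (n + 2) → ℂˣ)) p = p
      exact aeval_diagonalSubst_one p
    exact (projMap_congr' key _ (by simp)).trans Proj.map_id
  ext : 1
  rw [← cancel_mono (SmoothHypersurface.hypersurfaceι F).left, diagonalAut_left_comp_ι, Over.id_left,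
    Category.id_comp, hP, Over.id_left, Category.comp_id]

include hm

/-- **The section is `μₘ`-equivariant: `fermatSection ≫ g_a = g_{a ∘ k₀.succAbove} ≫ fermatSection`**
for `a ∈ μₘⁿ⁺³` (checked after composing with the monomorphism `ι`). [cite: Shioda1979HodgeFermat, §1] -/
theorem fermatSection_comp_diagonalAut (a : fermatGroup (n + 1) m) :
    fermatSection hm k₀ ≫ diagonalAut (fermatPolynomial ℂ (n + 1) m) (fermatGroup_le_diagonalStabilizer m a.2) =
      diagonalAut (fermatPolynomial ℂ n m)
          (fermatGroup_le_diagonalStabilizer m (comp_succAbove_mem_fermatGroup k₀ a.2)) ≫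
        fermatSection hm k₀ := by
  have hsq : (ProjectiveSpace.skipMap k₀).left ≫ (diagonalProjMap (a : Fin (n + 3) → ℂˣ)).left =
      (diagonalProjMap ((a : Fin (n + 3) → ℂˣ) ∘ k₀.succAbove)).left ≫ (ProjectiveSpace.skipMap k₀).left := by
    rw [← Over.comp_left, skipMap_comp_diagonalProjMap, Over.comp_left]
  ext : 1
  rw [Over.comp_left, Over.comp_left, ← cancel_mono (ι (n + 1), m).left, Category.assoc, Category.assoc,
    diagonalAut_left_comp_ι, fermatSection_left_comp_ι_assoc, fermatSection_left_comp_ι,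
    diagonalAut_left_comp_ι_assoc, hsq]

/-- **The rotation of the coordinate `x_{k₀}` fixes the section `Xⁿₘ ↪ Xⁿ⁺¹ₘ` pointwise**:
`fermatSection ≫ g_{(1,…,ζ,…,1)} = fermatSection` (`ζ ∈ μₘ` in slot `k₀`).
[cite: Shioda1979HodgeFermat, §1] [cite: Ran1980, §1 Lemma 1.4] -/
theorem fermatSection_comp_diagonalAut_single (ζ : rootsOfUnity m ℂ) :
    fermatSection hm k₀ ≫ diagonalAut (fermatPolynomial ℂ (n + 1) m)
        (fermatGroup_le_diagonalStabilizer m (fermatGroupSingle k₀ ζ).2) = fermatSection hm k₀ := by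
  rw [fermatSection_comp_diagonalAut hm k₀ (fermatGroupSingle k₀ ζ),
    diagonalAut_eq_id_of_eq_one _ (fermatGroupSingle_comp_succAbove k₀ ζ), Category.id_comp]

end Equivariance

end Literature.AlgebraicGeometry.HodgeTheory

end
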